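import Summits.ResolutionOfSingularities.ResolutionOfSingularities.Theorems.PurelyInseparableDim4LoopERegion
import Summits.ResolutionOfSingularities.ResolutionOfSingularities.Theorems.PurelyInseparableDim4ScopeLocalGame
import HarnessLib

/-!
# [OURS · res-dim4-pi · F4-C-loc] LOOP-E (crit-1's lone-plane hop 4-cycle) AND LOOP-E′ HAVE NO PLAY IN THE LOCAL GAME:
  over `𝔽₃` every region state is an A-win of the local in-scope game FOR THE LONE-COMPONENT RULE ITSELF — every
  local reply is a chart origin and the plane wins within four moves (‖ K)

Cell `res-dim4-pi` (D-0157 DOOR 2, wave 2), seat `res-dim4-p-6` g2; companion of res-dim4-p-8 g2's GLOBAL certificate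
`…LoopERegion` (p664169: LOOP-E `LoopC.e0 … e4` / table `eR` and the `x₂`-free LOOP-E′ `g0 … g4` / `gR` over `𝔽₃`
at `(p,q) = (3,3)` defeat every LONE-COMPONENT rule in the GLOBAL game `Edge` — the separating replies are the HOPS
`(0,0,2,1)` / `(0,0,1,2)`).  Specimen of res-dim4-crit-1 (V-A-30 (G)), K = crit-1 ∧ eng-w4 g2 ∧ eng-w5 g2 ∧
idea-2 g3 ∧ kernel.  crit-1's j317088 pre-runs read «A escapes LOOP-E locally by the line / the point»; here the
sharper statement: the LONE COMPONENT ITSELF wins locally.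

* §1 the local win certificates (p-6's `rwinCertB` format of `…LoopCLocalEscape`, reply class `localB`): the rows are
  p-8's literal states and their chart-ORIGIN children, computed by res-dim4-p-13's `StepKit.stepD` (no hand
  transcription): at `e0`/`e4` the plane `V(x₁,x₄)` has exactly the two origin replies (charts `x₁`, `x₄`), both
  children have NO local reply; at `e2` the plane `V(x₁,x₃)` has the `x₁`-origin reply only (`↦ e3`), at `e3` the two
  origin replies, then once more, then none — depth ≤ 4; identical shape for LOOP-E′.  Own replay first
  (work/loopc/loopE_local.py, loopE_rows.py).
* §2 **`loopE_localWins : ∀ s ∈ trapSet LoopC.eR, RWins 3 localB s`**, **`loopE'_localWins`** (table `gR`), and the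
  `EdgeLoc` reading `loopE_separates` (GLOBAL: `LoopC.exists_inScope_branch_of_loneComponentRule`; LOCAL: A wins from
  the same states with the same rule).

Scope (honest): `𝔽₃`-rational replies (the all-fields lift by `UniformNoReply` witnesses is not done here); statements
about OUR frame; F4-C-loc(3,3) / F4-C-glob(3,3) in their ∃-rule form stay OPEN.  [OURS · counted 0 · kernel certificate;
AI kernel work, weaker than expert review.]  NOTHING here is a statement about resolution of singularities; resolution in
dimension `≥ 4` / characteristic `p > 0` is NOT proved by anything in this file.  bears_on: LADDER-RESOLUTION:D157-DOOR2
(res-dim4-pi · F4-C-loc(3,3) · C-LOOP-E).  Host item (DR-157-C): `stmt-ResolutionOfSingularities-16155`, helper.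
-/

set_option linter.dupNamespace false -- mandated namespace of this single-conjunct summit

noncomputable section

open MvPolynomial Finset

namespace Summit.ResolutionOfSingularities.ResolutionOfSingularities.Theorems.PIDim4

namespace LoopCLocal

open Literature.AlgebraicGeometry.Resolution
open Literature.AlgebraicGeometry.Resolution.CentreBlowup
open StepKit LoopC InScopeWinCert

/-! ## §1 The local win certificates (children computed by `stepD`) -/

/-- LOOP-E, local certificate: p-8's `e0 … e4` with the lone plane as A's move, followed by every chart-origin
descendant (the only `𝔽₃`-rational local replies), parents before children. [OURS · data] -/
def loopELocalCert : ICert (ZMod 3) :=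
  [(e0, {0, 3}, none), (e4, {0, 3}, none), (e2, {0, 2}, none), (e1, {0, 3}, none), (e3, {0, 2}, none),
   (stepD 3 {0, 3} 0 0 e0, {0, 3}, none), (stepD 3 {0, 3} 3 0 e0, {0, 3}, none),
   (stepD 3 {0, 3} 0 0 e4, {0, 3}, none), (stepD 3 {0, 3} 3 0 e4, {0, 3}, none),
   (stepD 3 {0, 2} 0 0 e2, {0, 2}, none),
   (stepD 3 {0, 2} 0 0 e3, {0, 2}, none), (stepD 3 {0, 2} 2 0 e3, {0, 2}, none),
   (stepD 3 {0, 2} 0 0 (stepD 3 {0, 2} 0 0 e2), {0, 2}, none),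
   (stepD 3 {0, 2} 2 0 (stepD 3 {0, 2} 0 0 e2), {0, 2}, none),
   (stepD 3 {0, 2} 0 0 (stepD 3 {0, 2} 0 0 e3), {0, 2}, none),
   (stepD 3 {0, 2} 2 0 (stepD 3 {0, 2} 0 0 e3), {0, 2}, none),
   (stepD 3 {0, 2} 0 0 (stepD 3 {0, 2} 0 0 (stepD 3 {0, 2} 0 0 e2)), {0, 2}, none),
   (stepD 3 {0, 2} 2 0 (stepD 3 {0, 2} 0 0 (stepD 3 {0, 2} 0 0 e2)), {0, 2}, none)]

/-- The LOOP-E local certificate checks. [OURS · ‖ K] -/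
theorem rwinCertB_loopELocal : rwinCertB 3 localB loopELocalCert = true := by decide +kernel

/-- LOOP-E′ (x₂-free, three variables), local certificate in the same shape. [OURS · data] -/
def loopE'LocalCert : ICert (ZMod 3) :=
  [(g0, {0, 3}, none), (g4, {0, 3}, none), (g2, {0, 2}, none), (g1, {0, 3}, none), (g3, {0, 2}, none),
   (stepD 3 {0, 3} 0 0 g0, {0, 3}, none), (stepD 3 {0, 3} 3 0 g0, {0, 3}, none),
   (stepD 3 {0, 3} 0 0 g4, {0, 3}, none), (stepD 3 {0, 3} 3 0 g4, {0, 3}, none),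
   (stepD 3 {0, 2} 0 0 g2, {0, 2}, none),
   (stepD 3 {0, 2} 0 0 g3, {0, 2}, none), (stepD 3 {0, 2} 2 0 g3, {0, 2}, none),
   (stepD 3 {0, 2} 0 0 (stepD 3 {0, 2} 0 0 g2), {0, 2}, none),
   (stepD 3 {0, 2} 2 0 (stepD 3 {0, 2} 0 0 g2), {0, 2}, none),
   (stepD 3 {0, 2} 0 0 (stepD 3 {0, 2} 0 0 g3), {0, 2}, none),
   (stepD 3 {0, 2} 2 0 (stepD 3 {0, 2} 0 0 g3), {0, 2}, none),
   (stepD 3 {0, 2} 0 0 (stepD 3 {0, 2} 0 0 (stepD 3 {0, 2} 0 0 g2)), {0, 2}, none),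
   (stepD 3 {0, 2} 2 0 (stepD 3 {0, 2} 0 0 (stepD 3 {0, 2} 0 0 g2)), {0, 2}, none)]

/-- The LOOP-E′ local certificate checks. [OURS · ‖ K] -/
theorem rwinCertB_loopE'Local : rwinCertB 3 localB loopE'LocalCert = true := by decide +kernel

/-! ## §2 Conclusions -/

/-- **LOOP-E HAS NO PLAY IN THE LOCAL GAME**: every state of p-8's LOOP-E region is an A-win of the LOCAL in-scope game
over `𝔽₃`, A playing the LONE plane component (the rule class that LOOP-E defeats globally). [OURS · ‖ K] -/
theorem loopE_localWins : ∀ s ∈ trapSet eR, RWins 3 localB s := by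
  have hcert := rWins_of_rwinCertB rwinCertB_loopELocal
  rintro s ⟨sw, hsw, rfl⟩
  simp only [eR, List.mem_cons, List.not_mem_nil, or_false] at hsw
  rcases hsw with rfl | rfl | rfl | rfl | rfl
  · exact hcert (e0, {0, 3}, none) (by simp [loopELocalCert])
  · exact hcert (e1, {0, 3}, none) (by simp [loopELocalCert])
  · exact hcert (e2, {0, 2}, none) (by simp [loopELocalCert])
  · exact hcert (e3, {0, 2}, none) (by simp [loopELocalCert])
  · exact hcert (e4, {0, 3}, none) (by simp [loopELocalCert])

/-- **LOOP-E′ has no play in the local game** either. [OURS · ‖ K] -/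
theorem loopE'_localWins : ∀ s ∈ trapSet gR, RWins 3 localB s := by
  have hcert := rWins_of_rwinCertB rwinCertB_loopE'Local
  rintro s ⟨sw, hsw, rfl⟩
  simp only [gR, List.mem_cons, List.not_mem_nil, or_false] at hsw
  rcases hsw with rfl | rfl | rfl | rfl | rfl
  · exact hcert (g0, {0, 3}, none) (by simp [loopE'LocalCert])
  · exact hcert (g1, {0, 3}, none) (by simp [loopE'LocalCert])
  · exact hcert (g2, {0, 2}, none) (by simp [loopE'LocalCert])
  · exact hcert (g3, {0, 2}, none) (by simp [loopE'LocalCert])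
  · exact hcert (g4, {0, 3}, none) (by simp [loopE'LocalCert])

/-- The roots in particular. [OURS · ‖ K] -/
theorem e0_localWins : RWins 3 localB e0.toState ∧ RWins 3 localB g0.toState :=
  ⟨loopE_localWins _ e0_mem, loopE'_localWins _ g0_mem⟩

/-- **LOOP-E separates the games for the lone-component class too** (‖ K over `𝔽₃`): GLOBAL — every rule blowing up the
lone component whenever there is exactly one has an infinite in-scope branch in the region
(`LoopC.exists_inScope_branch_of_loneComponentRule`); LOCAL — with the same centres A wins from every region state,
i.e. the region meets the ∀-state clause of `TerminatesInScopeLoc 3 3` over `𝔽₃`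
(`terminatesInScopeLoc_iff_forall_rWins`). [OURS · ‖ K] -/
theorem loopE_meets_localClause : (∀ s ∈ trapSet eR, RWins 3 localB s) ∧ ∀ s ∈ trapSet gR, RWins 3 localB s :=
  ⟨loopE_localWins, loopE'_localWins⟩

end LoopCLocal

end Summit.ResolutionOfSingularities.ResolutionOfSingularities.Theorems.PIDim4

end
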